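import Literature.AlgebraicGeometry.HodgeTheory.HodgeLociCountableOverCurves
import Literature.AlgebraicGeometry.HodgeTheory.HodgeGenericPointsComeagre
import HarnessLib

/-!
# Granted Griffiths' theorem, the non-Hodge-generic points of ANY smooth projective family lie in a countable
# union of local analytic hypersurfaces — and over a CURVE they are COUNTABLE (Deligne 1972 Prop. 7.5, zero-set
# form; no Cattani–Deligne–Kaplan)

Family `hodge`, layer `Literature/AlgebraicGeometry/HodgeTheory`. Theorems only (no definition, no named
fact). Written by the prover seat `hodge-nonav-prover-Ax` (g13, cell `hodge-nonav`), programme «AE»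
(route `HodgeConjecture/CyclicUnitaryPowers`, `--supports stmt-HodgeConjecture-19544`).

`HodgeGenericPointsComeagre` (same seat, g11) derives from the named fact
`Griffiths1968_holomorphicHodgeSubbundles` (Voisin I Thm. 10.3: holomorphic frames of every `F^p` along flat
trivialisations) that the non-Hodge-generic points of a smooth projective family over a smooth
quasi-projective base form a MEAGRE set. With the zero-set form of the dichotomy
(`hodgeLoci_subset_zeroSet_of_holomorphicFrame`) the same chain gives the sharper statements, for ALL
fibre dimensions `n` and degrees `k` (the weight-2-frames files of this programme avoid the named fact for
surfaces; here it is the input):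

* `hodgeLociAlternative_of_griffiths1968` — the local alternative «all of the chart, or inside a local
  analytic hypersurface `{t ∈ W | g (ψ t) = 0}`» for one family, from Griffiths' fact;
* `exists_countable_analyticCover_not_isHodgeGenericPoint_of_griffiths1968` — the non-generic points lie in
  a COUNTABLE union of such sets (`exists_countable_cover_not_isHodgeGenericPoint_of_lociAlternative`);
* `countable_setOf_not_isHodgeGenericPoint_of_griffiths1968_curve`,
  `exists_countable_isHodgeGenericPoint_of_griffiths1968_curve` — over a ONE-dimensional base the
  non-generic points are COUNTABLE (`countable_zeroSet_comp_chart_fin_one`): for one-parameter families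
  «very general» in Deligne's analytic sense IS «all but countably many», granted Griffiths only.

Honest scope: CONDITIONAL on `Griffiths1968_holomorphicHodgeSubbundles` (a print theorem, item of the
tree's debt list); nothing here says HC or any rung is proved.

## References

* [Deligne1972WeilK3] P. Deligne, La conjecture de Weil pour les surfaces K3, Invent. Math. 15 (1972),
  Prop. 7.5.
* [VoisinHodgeI2002] C. Voisin, Hodge Theory and Complex Algebraic Geometry I (2002), §10.2.1 Thm. 10.3.
* [VoisinHodgeII2003] C. Voisin, Hodge Theory and Complex Algebraic Geometry II (2003), §5.3.1 Lemma 5.13.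
* [Griffiths1968PeriodsII] P. Griffiths, Periods of integrals on algebraic manifolds II, Amer. J. Math. 90
  (1968), Thm. 1.1.
* [FritzscheGrauert2002] K. Fritzsche, H. Grauert, From Holomorphic Functions to Complex Manifolds, GTM 213
  (2002), Ch. I §8.
-/

noncomputable section

open CategoryTheory AlgebraicGeometry
open _root_.Topology _root_.Filter
open scoped TensorProduct
open Literature.AlgebraicTopology.SingularHomology
open Literature.AlgebraicGeometry.Motives

namespace Literature.AlgebraicGeometry.HodgeTheory

section HodgeTheory

/-! ### The local alternative from Griffiths' theorem -/

/-- **Hodge loci are cut out by holomorphic equations, granted Griffiths' theorem** (Voisin II Lemma 5.13;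
the zero-set form of `hodgeLociDichotomy_of_griffiths1968`, same setting): every point `t₁` has
arbitrarily small path-connected open neighbourhoods `W` such that for every rational tensor `ζ`, every
`x ∈ W` and every admissible state `Tx` at `x`, the locus where `ζ` is a weight-`0` Hodge tensor along
the continuations of `Tx` inside `W` is EITHER all of `W`, OR contained in a set
`Z = {t ∈ W' | g (ψ t) = 0}` (`W'` path-connected open in the source of a chart `ψ`, `g` holomorphic on
`ψ(W')`, non-zero somewhere), nowhere dense and closed in `W`. [cite: VoisinHodgeII2003, §5.3.1 Lemma 5.13]
[cite: VoisinHodgeI2002, §10.2.1 Thm. 10.3] [cite: Deligne1972WeilK3, Prop. 7.5] -/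
theorem hodgeLociAlternative_of_griffiths1968 (hG : Griffiths1968_holomorphicHodgeSubbundles)
    [HodgeTensorFacts.{0, 0}] {𝒳 S : SchemeOver ℂ} (f : 𝒳 ⟶ S) (n k d : ℕ)
    (hf : IsSmoothProjectiveFamily f n) (hS : IsQuasiProjectiveOver S)
    [AlgebraicGeometry.SmoothOfRelativeDimension d S.hom]
    (hU : IsCohomologicallyLocallyTrivialOn f (Set.univ : Set (ComplexPoints S)))
    (A : ∀ t : ComplexPoints S, HodgeModel n (fiberOver f t)) (hA : ∀ t, (A t).IsHodgeSymmetric)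
    [∀ t, Module.Finite ℚ (singularCohomology ℚ ℚ (ComplexPoints (fiberOver f t)) k)]
    (s t₁ : (Set.univ : Set (ComplexPoints S))) (N : Set (Set.univ : Set (ComplexPoints S)))
    (hN : N ∈ 𝓝 t₁) :
    ∃ W : Set (Set.univ : Set (ComplexPoints S)), IsOpen W ∧ t₁ ∈ W ∧ W ⊆ N ∧ IsPathConnected W ∧
      ∀ (a b : ℕ) (ζ : hodgeTensorSpace (singularCohomology ℚ ℚ (ComplexPoints (fiberOver f
        (Subtype.val s))) k) a b) (x : (Set.univ : Set (ComplexPoints S))),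
        x ∈ W → ∀ (Tx : singularCohomology ℚ ℚ (ComplexPoints (fiberOver f (Subtype.val s))) k ≃ₗ[ℚ]
          singularCohomology ℚ ℚ (ComplexPoints (fiberOver f (Subtype.val x))) k),
        (∃ δ : Path.Homotopic.Quotient s x,
          ∀ v, ofRatClass _ k (Tx v) = transportFun f k hU δ (ofRatClass _ k v)) →
        (∀ t ∈ W, ∀ (ε : Path x t), (∀ r, ε r ∈ W) → ∀ (T : singularCohomology ℚ ℚ (ComplexPoints (fiberOver f
          (Subtype.val s))) k ≃ₗ[ℚ]
          singularCohomology ℚ ℚ (ComplexPoints (fiberOver f (Subtype.val t))) k),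
          (∀ v, ofRatClass _ k (T v) = transportFun f k hU ⟦ε⟧ (ofRatClass _ k (Tx v))) →
          ζ ∈ ((((A t.1).hodgeStructure (hf.isSmoothProjective t.1) (hA t.1) k).comapEquiv T).tensorSpace
            a b).hodgeClasses 0) ∨
        ∃ Z : Set (Set.univ : Set (ComplexPoints S)),
          (∃ (W' : Set (Set.univ : Set (ComplexPoints S)))
            (ψ : OpenPartialHomeomorph (Set.univ : Set (ComplexPoints S)) (Fin d → ℂ)) (g : (Fin d → ℂ) → ℂ),
            IsOpen W' ∧ IsPathConnected W' ∧ W' ⊆ ψ.source ∧ AnalyticOnNhd ℂ g (ψ '' W') ∧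
            (∃ t' ∈ W', g (ψ t') ≠ 0) ∧ Z = {t | t ∈ W' ∧ g (ψ t) = 0}) ∧
          IsNowhereDense Z ∧ (∀ t ∈ W, t ∈ closure Z → t ∈ Z) ∧
        {t : (Set.univ : Set (ComplexPoints S)) | t ∈ W ∧ ∀ (ε : Path x t),
          (∀ r, ε r ∈ W) → ∀ (T : singularCohomology ℚ ℚ (ComplexPoints (fiberOver f (Subtype.val s))) k ≃ₗ[ℚ]
            singularCohomology ℚ ℚ (ComplexPoints (fiberOver f (Subtype.val t))) k),
          (∀ v, ofRatClass _ k (T v) = transportFun f k hU ⟦ε⟧ (ofRatClass _ k (Tx v))) →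
          ζ ∈ ((((A t.1).hodgeStructure (hf.isSmoothProjective t.1) (hA t.1) k).comapEquiv T).tensorSpace
            a b).hodgeClasses 0} ⊆ Z := by
  obtain ⟨W₀, hW₀o, ht₁W₀, hW₀N, hW₀pc, ψ, hW₀ψ, hfr⟩ := hG f n k d hf hS hU A hA s t₁ N hN
  -- topology of `S(ℂ)`: a manifold, hence locally path connected
  haveI : AlgebraicGeometry.LocallyOfFiniteType S.hom := hS.locallyOfFiniteType
  haveI : AlgebraicGeometry.IsSeparated S.hom := hS.isVarietyPair_ofScheme.isSeparated
  haveI : T2Space (ComplexPoints S) := Literature.NumberTheory.Transcendental.t2Space_algPoints_holds _ ℂ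
  letI := Motives.ComplexPoints.chartedSpace S d
  haveI : LocallyPathConnectedSpace (ComplexPoints S) :=
    ChartedSpace.locallyPathConnectedSpace (EuclideanSpace ℝ (Fin (2 * d))) _
  haveI : LocallyPathConnectedSpace (Set.univ : Set (ComplexPoints S)) :=
    isOpen_univ.locallyPathConnectedSpace
  have hrat : ∀ (x y : (Set.univ : Set (ComplexPoints S))) (γ : Path.Homotopic.Quotient x y)
      (α : complexBetti (fiberOver f x.1) k), IsRationalClass α →
      IsRationalClass (transportFun f k hU γ α) :=
    fun x y γ α hα ↦ isRationalClass_transportFun_of_isSmoothProjectiveFamily f k d hf hS γ hα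
  by_cases hjs : Joined s t₁
  · -- an admissible reference state at `t₁` exists: graded frames on a smaller `W`, then the dichotomy
    obtain ⟨T₁, hT₁⟩ := exists_ratTransport f k hU hrat (⟦hjs.somePath⟧ : Path.Homotopic.Quotient s t₁)
    have hT₁' : ∃ δ₁ : Path.Homotopic.Quotient s t₁,
        ∀ v, ofRatClass _ k (T₁ v) = transportFun f k hU δ₁ (ofRatClass _ k v) := ⟨_, hT₁⟩
    choose r w hw hwhol using hfr T₁ hT₁'
    obtain ⟨W, hWo, ht₁W, hWW₀, hWpc, hW⟩ := exists_holomorphicFrame_of_subbundleFrames f k hU s hrat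
      (fun t ↦ (A t.1).hodgeStructure (hf.isSmoothProjective t.1) (hA t.1) k) hW₀o hW₀pc ψ hW₀ψ
      ht₁W₀ hT₁' r w hw hwhol
    refine ⟨W, hWo, ht₁W, hWW₀.trans hW₀N, hWpc, fun a b ζ x hx Tx hTx ↦ ?_⟩
    obtain ⟨N', deg, e, hF, hol₁, hol₂⟩ := hW x hx Tx hTx
    have hWψ : W ⊆ ψ.source := hWW₀.trans hW₀ψ
    rcases hodgeLoci_subset_zeroSet_of_holomorphicFrame f k hU s hrat
      (fun t ↦ (A t.1).hodgeStructure (hf.isSmoothProjective t.1) (hA t.1) k) hWpc ψ hWψ hx hTx e hF hol₁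
      hol₂ a b ζ with hfull | ⟨g, hg, hne, hsub⟩
    · exact Or.inl hfull
    · exact Or.inr ⟨{t | t ∈ W ∧ g (ψ t) = 0}, ⟨W, ψ, g, hWo, hWpc, hWψ, hg, hne, rfl⟩,
        isNowhereDense_zeroSet_comp_chart hWo hWpc ψ hWψ hg hne,
        fun t ht htc ↦ mem_zeroSet_comp_chart_of_mem_closure hWo ψ hWψ hg ht htc, hsub⟩
  · -- no admissible state near `t₁`: the condition is void on `W₀`
    refine ⟨W₀, hW₀o, ht₁W₀, hW₀N, hW₀pc, fun a b ζ x hx Tx hTx ↦ ?_⟩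
    exfalso
    obtain ⟨δ, -⟩ := hTx
    induction δ using Quotient.inductionOn with
    | h γ => exact hjs (Joined.trans ⟨γ⟩ (hW₀pc.joinedIn x hx t₁ ht₁W₀).joined)


/-! ### The countable analytic cover, all fibre dimensions and degrees -/

/-- **Granted Griffiths' theorem, the non-Hodge-generic points of a smooth projective family over a smooth
quasi-projective base lie in a COUNTABLE union of local analytic hypersurfaces** (Deligne 1972 Prop. 7.5 ∕
André 1992 Lemma 4 in the sharper «analytic» form). [cite: Deligne1972WeilK3, Prop. 7.5]
[cite: VoisinHodgeII2003, §5.3.1 Lemma 5.13] [cite: VoisinHodgeI2002, §10.2.1 Thm. 10.3] -/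
theorem exists_countable_analyticCover_not_isHodgeGenericPoint_of_griffiths1968
    (hG : Griffiths1968_holomorphicHodgeSubbundles)
    [HodgeTensorFacts.{0, 0}] {𝒳 S : SchemeOver ℂ} (f : 𝒳 ⟶ S) (n k d : ℕ)
    (hf : IsSmoothProjectiveFamily f n) (hS : IsQuasiProjectiveOver S)
    [AlgebraicGeometry.SmoothOfRelativeDimension d S.hom]
    (hU : IsCohomologicallyLocallyTrivialOn f (Set.univ : Set (ComplexPoints S)))
    (A : ∀ t : ComplexPoints S, HodgeModel n (fiberOver f t)) (hA : ∀ t, (A t).IsHodgeSymmetric)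
    [∀ t, Module.Finite ℚ (singularCohomology ℚ ℚ (ComplexPoints (fiberOver f t)) k)] :
    ∃ 𝒞 : Set (Set (Set.univ : Set (ComplexPoints S))), 𝒞.Countable ∧
      (∀ Z ∈ 𝒞, (∃ (W' : Set (Set.univ : Set (ComplexPoints S)))
            (ψ : OpenPartialHomeomorph (Set.univ : Set (ComplexPoints S)) (Fin d → ℂ)) (g : (Fin d → ℂ) → ℂ),
            IsOpen W' ∧ IsPathConnected W' ∧ W' ⊆ ψ.source ∧ AnalyticOnNhd ℂ g (ψ '' W') ∧
            (∃ t' ∈ W', g (ψ t') ≠ 0) ∧ Z = {t | t ∈ W' ∧ g (ψ t) = 0}) ∧ IsNowhereDense Z) ∧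
      {t : (Set.univ : Set (ComplexPoints S)) | ¬ IsHodgeGenericPoint f k hU hf A hA t} ⊆ ⋃₀ 𝒞 :=
  exists_countable_cover_not_isHodgeGenericPoint_of_lociAlternative f n k d hf hS hU A hA
    (fun Z ↦ (∃ (W' : Set (Set.univ : Set (ComplexPoints S)))
            (ψ : OpenPartialHomeomorph (Set.univ : Set (ComplexPoints S)) (Fin d → ℂ)) (g : (Fin d → ℂ) → ℂ),
            IsOpen W' ∧ IsPathConnected W' ∧ W' ⊆ ψ.source ∧ AnalyticOnNhd ℂ g (ψ '' W') ∧
            (∃ t' ∈ W', g (ψ t') ≠ 0) ∧ Z = {t | t ∈ W' ∧ g (ψ t) = 0}))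
    fun s t₁ N hN ↦ hodgeLociAlternative_of_griffiths1968 hG f n k d hf hS hU A hA s t₁ N hN

/-! ### Over a curve: countably many exceptional points -/

/-- **Granted Griffiths' theorem, over a ONE-dimensional base the non-Hodge-generic points of a smooth
projective family are COUNTABLE** (every fibre dimension `n`, every degree `k`): the sets of the countable
analytic cover are zero sets of one-variable holomorphic functions, hence countable
(`countable_zeroSet_comp_chart_fin_one`). No Cattani–Deligne–Kaplan. [cite: Deligne1972WeilK3, Prop. 7.5]
[cite: VoisinHodgeI2002, §10.2.1 Thm. 10.3] [cite: FritzscheGrauert2002, Chapter I §8] -/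
theorem countable_setOf_not_isHodgeGenericPoint_of_griffiths1968_curve
    (hG : Griffiths1968_holomorphicHodgeSubbundles)
    [HodgeTensorFacts.{0, 0}] {𝒳 S : SchemeOver ℂ} (f : 𝒳 ⟶ S) (n k : ℕ)
    (hf : IsSmoothProjectiveFamily f n) (hS : IsQuasiProjectiveOver S)
    [AlgebraicGeometry.SmoothOfRelativeDimension 1 S.hom]
    (hU : IsCohomologicallyLocallyTrivialOn f (Set.univ : Set (ComplexPoints S)))
    (A : ∀ t : ComplexPoints S, HodgeModel n (fiberOver f t)) (hA : ∀ t, (A t).IsHodgeSymmetric)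
    [∀ t, Module.Finite ℚ (singularCohomology ℚ ℚ (ComplexPoints (fiberOver f t)) k)] :
    {t : (Set.univ : Set (ComplexPoints S)) | ¬ IsHodgeGenericPoint f k hU hf A hA t}.Countable := by
  obtain ⟨𝒞, h𝒞c, h𝒞s, hcov⟩ :=
    exists_countable_analyticCover_not_isHodgeGenericPoint_of_griffiths1968 hG f n k 1 hf hS hU A hA
  refine Set.Countable.mono hcov (h𝒞c.sUnion fun Z hZ ↦ ?_)
  obtain ⟨⟨W', ψ, g, -, hW'pc, hW'ψ, hg, hne, rfl⟩, -⟩ := h𝒞s Z hZ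
  exact countable_zeroSet_comp_chart_fin_one hW'pc ψ hW'ψ hg hne

/-- **Consumer form**: granted Griffiths' theorem, a COUNTABLE subset `C` of the one-dimensional base off
which every point is Hodge generic. [cite: Deligne1972WeilK3, Prop. 7.5] [cite: VoisinHodgeI2002, §10.2.1 Thm. 10.3] -/
theorem exists_countable_isHodgeGenericPoint_of_griffiths1968_curve
    (hG : Griffiths1968_holomorphicHodgeSubbundles)
    [HodgeTensorFacts.{0, 0}] {𝒳 S : SchemeOver ℂ} (f : 𝒳 ⟶ S) (n k : ℕ)
    (hf : IsSmoothProjectiveFamily f n) (hS : IsQuasiProjectiveOver S)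
    [AlgebraicGeometry.SmoothOfRelativeDimension 1 S.hom]
    (hU : IsCohomologicallyLocallyTrivialOn f (Set.univ : Set (ComplexPoints S)))
    (A : ∀ t : ComplexPoints S, HodgeModel n (fiberOver f t)) (hA : ∀ t, (A t).IsHodgeSymmetric)
    [∀ t, Module.Finite ℚ (singularCohomology ℚ ℚ (ComplexPoints (fiberOver f t)) k)] :
    ∃ C : Set (ComplexPoints S), C.Countable ∧
      ∀ s : (Set.univ : Set (ComplexPoints S)), s.1 ∉ C → IsHodgeGenericPoint f k hU hf A hA s := by
  refine ⟨Subtype.val '' {t : (Set.univ : Set (ComplexPoints S)) | ¬ IsHodgeGenericPoint f k hU hf A hA t},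
    (countable_setOf_not_isHodgeGenericPoint_of_griffiths1968_curve hG f n k hf hS hU A hA).image _,
    fun s hs ↦ ?_⟩
  by_contra h
  exact hs ⟨s, h, rfl⟩

end HodgeTheory

end Literature.AlgebraicGeometry.HodgeTheory

end
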